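import Summits.AtomisticToContinuum.Crystallization.Theorems.ExcessDecayLiouvilleEquationBounds
import Summits.AtomisticToContinuum.Crystallization.Theorems.ExcessDecayLiouvilleLatticeSums

/-!
# Route `ExcessDecayLiouville`: the energy identity — `PhononStability` is coercivity of the force-constant OPERATOR

Entry point of every linear theory (steps (c)/(d) of the excess-decay argument for item `ExcessDecay`,
stmt-AtomisticToContinuum-9334, and of `LinearLiouville` for `HcpLiouville`).  The harmonic-stability
hypothesis `PhononStability` bounds the QUADRATIC FORM `½ Σ'_p Σ'_q [p≠q] Hess₀(p−q)(v p − v q)` from below;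
the linearised force equation (`norm_linearised_equation_le`) is about the OPERATOR
`(L v)(p) = Σ'_{q ≠ p} K(p−q)(v p − v q)`, `K(e)w = h(|e|²)w + 2⟪e,w⟫h′(|e|²)e`.  They are linked by the
summation-by-parts identity (finitely supported `v`, site set `S` of an admissible datum)

`Σ'_p ⟪(L v)(p), v p⟫ = ½ Σ'_p Σ'_q [p ≠ q] Hess₀ (p − q) (v p − v q)`   (`energy_identity`),

proved here from `Hess₀ e w = ⟪K(e)w, w⟫` (`inner_forceConst_eq_Hess₀`), evenness of `K` in the bond and
Fubini for the absolutely summable double family `⟪K(p−q)(v p − v q), v p⟫` (rows `O(|p−q|⁻⁸)`, finitely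
many nonzero rows).  All `[folklore]`; helper lemmas, nothing here closes an item.
-/

noncomputable section

namespace Summit.AtomisticToContinuum.Crystallization.Theorems.ExcessDecayLiouville

open scoped BigOperators Topology InnerProductSpace RealInnerProductSpace
open Literature.MathematicalPhysics.StatisticalMechanics
open Summit.AtomisticToContinuum.Crystallization.Theorems.PhononStabilityNegative

/-! ## Algebra of the force-constant map `K(e)w = h(|e|²)w + 2⟪e,w⟫h′(|e|²)e` -/

/-- `K` is even in the bond vector. [folklore] -/
theorem forceConst_neg_left (e w : EuclideanSpace ℝ (Fin 3)) :
    (-((‖-e‖ ^ 2)⁻¹) ^ 7 + ((‖-e‖ ^ 2)⁻¹) ^ 4) • w +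
        (2 * ⟪-e, w⟫ * (7 * ((‖-e‖ ^ 2)⁻¹) ^ 8 - 4 * ((‖-e‖ ^ 2)⁻¹) ^ 5)) • (-e) =
      (-((‖e‖ ^ 2)⁻¹) ^ 7 + ((‖e‖ ^ 2)⁻¹) ^ 4) • w +
        (2 * ⟪e, w⟫ * (7 * ((‖e‖ ^ 2)⁻¹) ^ 8 - 4 * ((‖e‖ ^ 2)⁻¹) ^ 5)) • e := by
  rw [norm_neg, inner_neg_left, smul_neg, ← neg_smul]
  congr 1
  ring_nf

/-- `K(e)` is additive in the displacement. [folklore] -/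
theorem forceConst_sub_right (e a b : EuclideanSpace ℝ (Fin 3)) :
    (-((‖e‖ ^ 2)⁻¹) ^ 7 + ((‖e‖ ^ 2)⁻¹) ^ 4) • (a - b) +
        (2 * ⟪e, a - b⟫ * (7 * ((‖e‖ ^ 2)⁻¹) ^ 8 - 4 * ((‖e‖ ^ 2)⁻¹) ^ 5)) • e =
      ((-((‖e‖ ^ 2)⁻¹) ^ 7 + ((‖e‖ ^ 2)⁻¹) ^ 4) • a +
          (2 * ⟪e, a⟫ * (7 * ((‖e‖ ^ 2)⁻¹) ^ 8 - 4 * ((‖e‖ ^ 2)⁻¹) ^ 5)) • e) -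
        ((-((‖e‖ ^ 2)⁻¹) ^ 7 + ((‖e‖ ^ 2)⁻¹) ^ 4) • b +
          (2 * ⟪e, b⟫ * (7 * ((‖e‖ ^ 2)⁻¹) ^ 8 - 4 * ((‖e‖ ^ 2)⁻¹) ^ 5)) • e) := by
  rw [inner_sub_right]
  module

/-- `K(e)(−w) = −K(e)w`. [folklore] -/
theorem forceConst_neg_right (e w : EuclideanSpace ℝ (Fin 3)) :
    (-((‖e‖ ^ 2)⁻¹) ^ 7 + ((‖e‖ ^ 2)⁻¹) ^ 4) • (-w) +
        (2 * ⟪e, -w⟫ * (7 * ((‖e‖ ^ 2)⁻¹) ^ 8 - 4 * ((‖e‖ ^ 2)⁻¹) ^ 5)) • e =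
      -((-((‖e‖ ^ 2)⁻¹) ^ 7 + ((‖e‖ ^ 2)⁻¹) ^ 4) • w +
        (2 * ⟪e, w⟫ * (7 * ((‖e‖ ^ 2)⁻¹) ^ 8 - 4 * ((‖e‖ ^ 2)⁻¹) ^ 5)) • e) := by
  rw [inner_neg_right]
  module

/-- **Pair symmetry**: with `w = a − b`, `⟪K(e)w, w⟫ = ⟪K(e)w, a⟫ + ⟪K(−e)(b − a), b⟫` — the pair term of the
quadratic form is the sum of the two "operator" terms seen from either end of the bond. [folklore] -/
theorem inner_forceConst_pair (e a b : EuclideanSpace ℝ (Fin 3)) :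
    ⟪(-((‖e‖ ^ 2)⁻¹) ^ 7 + ((‖e‖ ^ 2)⁻¹) ^ 4) • (a - b) +
        (2 * ⟪e, a - b⟫ * (7 * ((‖e‖ ^ 2)⁻¹) ^ 8 - 4 * ((‖e‖ ^ 2)⁻¹) ^ 5)) • e, a - b⟫ =
      ⟪(-((‖e‖ ^ 2)⁻¹) ^ 7 + ((‖e‖ ^ 2)⁻¹) ^ 4) • (a - b) +
          (2 * ⟪e, a - b⟫ * (7 * ((‖e‖ ^ 2)⁻¹) ^ 8 - 4 * ((‖e‖ ^ 2)⁻¹) ^ 5)) • e, a⟫ +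
        ⟪(-((‖-e‖ ^ 2)⁻¹) ^ 7 + ((‖-e‖ ^ 2)⁻¹) ^ 4) • (b - a) +
          (2 * ⟪-e, b - a⟫ * (7 * ((‖-e‖ ^ 2)⁻¹) ^ 8 - 4 * ((‖-e‖ ^ 2)⁻¹) ^ 5)) • (-e), b⟫ := by
  rw [forceConst_neg_left, show b - a = -(a - b) by abel, forceConst_neg_right, inner_neg_left,
    inner_sub_right]
  ring

section

variable {t : Fin 2 → EuclideanSpace ℝ (Fin 3)} {A : EuclideanSpace ℝ (Fin 3) →L[ℝ] EuclideanSpace ℝ (Fin 3)}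

/-! ## Summability of the operator rows and of the double family -/

/-- A finitely supported displacement is bounded. [folklore] -/
theorem exists_bound_of_finite_support {v : EuclideanSpace ℝ (Fin 3) → EuclideanSpace ℝ (Fin 3)}
    (hv : (Function.support v).Finite) : ∃ B : ℝ, 0 ≤ B ∧ ∀ x, ‖v x‖ ≤ B := by
  classical
  obtain ⟨B, hB⟩ := (hv.image fun x => ‖v x‖).bddAbove
  refine ⟨max B 0, le_max_right _ _, fun x => ?_⟩
  by_cases hx : v x = 0
  · rw [hx, norm_zero]; exact le_max_right _ _
  · exact (hB ⟨x, hx, rfl⟩).trans (le_max_left _ _)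

/-- The operator row is summable in `ℝ³`: `q ↦ [p≠q] K(p−q)(v p − v q)` for a site `p` and finitely
supported `v` (norm `≤ 38|p−q|⁻⁸(‖v p‖ + B)`). [folklore] -/
theorem summable_opRow (hA : Adm₀ A) (hI : Inner₀ t A)
    {v : EuclideanSpace ℝ (Fin 3) → EuclideanSpace ℝ (Fin 3)} (hv : (Function.support v).Finite)
    (p : Sites₀ t A) :
    Summable (fun q : Sites₀ t A => if (p : EuclideanSpace ℝ (Fin 3)) ≠ q then
      (-((‖(p : EuclideanSpace ℝ (Fin 3)) - q‖ ^ 2)⁻¹) ^ 7 + ((‖(p : EuclideanSpace ℝ (Fin 3)) - q‖ ^ 2)⁻¹) ^ 4) •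
          (v p - v q) +
        (2 * ⟪(p : EuclideanSpace ℝ (Fin 3)) - q, v p - v q⟫ *
          (7 * ((‖(p : EuclideanSpace ℝ (Fin 3)) - q‖ ^ 2)⁻¹) ^ 8 -
            4 * ((‖(p : EuclideanSpace ℝ (Fin 3)) - q‖ ^ 2)⁻¹) ^ 5)) • ((p : EuclideanSpace ℝ (Fin 3)) - q)
      else 0) := by
  classical
  obtain ⟨B, hB0, hB⟩ := exists_bound_of_finite_support hv
  refine Summable.of_norm_bounded
    ((summable_inv_pow_eight_sites hA hI p.2).mul_left (38 * (‖v p‖ + B))) fun q => ?_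
  by_cases hq : (p : EuclideanSpace ℝ (Fin 3)) = q
  · simp [hq]
  · have hne : (q : EuclideanSpace ℝ (Fin 3)) ≠ p := fun h => hq h.symm
    rw [if_pos hq, if_pos hne]
    have hd : (23 / 25 : ℝ) ≤ dist (p : EuclideanSpace ℝ (Fin 3)) q := dist_sites_ge hA hI p.2 q.2 hq
    have he : 9 / 10 ≤ ‖(p : EuclideanSpace ℝ (Fin 3)) - q‖ := by rw [← dist_eq_norm]; linarith
    refine (norm_forceConst_apply_le he _).trans ?_
    have hw : ‖v p - v q‖ ≤ ‖v p‖ + B := (norm_sub_le _ _).trans (add_le_add le_rfl (hB _))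
    have h8 : 0 ≤ (‖(p : EuclideanSpace ℝ (Fin 3)) - q‖⁻¹) ^ 8 := by positivity
    calc 38 * (‖(p : EuclideanSpace ℝ (Fin 3)) - q‖⁻¹) ^ 8 * ‖v p - v q‖
        ≤ 38 * (‖(p : EuclideanSpace ℝ (Fin 3)) - q‖⁻¹) ^ 8 * (‖v p‖ + B) := by gcongr
      _ = 38 * (‖v p‖ + B) * (dist (q : EuclideanSpace ℝ (Fin 3)) p)⁻¹ ^ 8 := by
          rw [dist_comm, dist_eq_norm]; ring

/-- The double family `G(p,q) = [p≠q] ⟪K(p−q)(v p − v q), v p⟫` is absolutely summable on `S × S`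
(it vanishes unless `v p ≠ 0`, i.e. off finitely many rows, and each row is `O(|p−q|⁻⁸)`). [folklore] -/
theorem summable_pairFamily (hA : Adm₀ A) (hI : Inner₀ t A)
    {v : EuclideanSpace ℝ (Fin 3) → EuclideanSpace ℝ (Fin 3)} (hv : (Function.support v).Finite) :
    Summable (fun pq : Sites₀ t A × Sites₀ t A =>
      if (pq.1 : EuclideanSpace ℝ (Fin 3)) ≠ pq.2 then
        ⟪(-((‖(pq.1 : EuclideanSpace ℝ (Fin 3)) - pq.2‖ ^ 2)⁻¹) ^ 7 +
              ((‖(pq.1 : EuclideanSpace ℝ (Fin 3)) - pq.2‖ ^ 2)⁻¹) ^ 4) • (v pq.1 - v pq.2) +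
            (2 * ⟪(pq.1 : EuclideanSpace ℝ (Fin 3)) - pq.2, v pq.1 - v pq.2⟫ *
              (7 * ((‖(pq.1 : EuclideanSpace ℝ (Fin 3)) - pq.2‖ ^ 2)⁻¹) ^ 8 -
                4 * ((‖(pq.1 : EuclideanSpace ℝ (Fin 3)) - pq.2‖ ^ 2)⁻¹) ^ 5)) •
              ((pq.1 : EuclideanSpace ℝ (Fin 3)) - pq.2), v pq.1⟫
      else 0) := by
  classical
  obtain ⟨B, hB0, hB⟩ := exists_bound_of_finite_support hv
  -- nonnegative majorant M(p,q) = [v p ≠ 0] [q ≠ p] 38 (2B) B |p−q|⁻⁸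
  set M : Sites₀ t A × Sites₀ t A → ℝ := fun pq =>
    if v pq.1 ≠ 0 then 38 * (2 * B) * B * (if (pq.2 : EuclideanSpace ℝ (Fin 3)) ≠ pq.1 then
      (dist (pq.2 : EuclideanSpace ℝ (Fin 3)) pq.1)⁻¹ ^ 8 else 0) else 0 with hM
  have hM0 : 0 ≤ M := fun pq => by
    simp only [hM]; split_ifs <;> positivity
  have hMsum : Summable M := by
    rw [summable_prod_of_nonneg hM0]
    constructor
    · intro p
      by_cases hp : v p ≠ 0
      · simp only [hM, if_pos hp]
        exact (summable_inv_pow_eight_sites hA hI p.2).mul_left _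
      · simp only [hM, if_neg hp]
        exact summable_zero
    · refine summable_of_ne_finset_zero (s := (finite_support_sites (t := t) (A := A) hv).toFinset) ?_
      intro p hp
      have hvp : ¬ v p ≠ 0 := fun h => hp ((Set.Finite.mem_toFinset _).2 h)
      simp only [hM, if_neg hvp, tsum_zero]
  refine Summable.of_norm_bounded hMsum fun pq => ?_
  obtain ⟨p, q⟩ := pq
  by_cases hvp : v p = 0
  · -- the whole term vanishes with v p... only through the inner product
    simp only [hvp, inner_zero_right]
    split_ifs <;> simp [hM, hvp]
  · by_cases hpq : (p : EuclideanSpace ℝ (Fin 3)) = q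
    · simp only [hpq, ne_eq, not_true_eq_false, if_false, norm_zero]
      exact hM0 _
    · have hne : (q : EuclideanSpace ℝ (Fin 3)) ≠ p := fun h => hpq h.symm
      simp only [hM, if_pos hpq, if_pos hvp, if_pos hne, Real.norm_eq_abs]
      have hd : (23 / 25 : ℝ) ≤ dist (p : EuclideanSpace ℝ (Fin 3)) q := dist_sites_ge hA hI p.2 q.2 hpq
      have he : 9 / 10 ≤ ‖(p : EuclideanSpace ℝ (Fin 3)) - q‖ := by rw [← dist_eq_norm]; linarith
      refine (abs_real_inner_le_norm _ _).trans ?_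
      refine (mul_le_mul (norm_forceConst_apply_le he _) (hB p) (norm_nonneg _) (by positivity)).trans ?_
      have hw : ‖v p - v q‖ ≤ 2 * B := by
        calc ‖v p - v q‖ ≤ ‖v p‖ + ‖v q‖ := norm_sub_le _ _
          _ ≤ B + B := add_le_add (hB _) (hB _)
          _ = 2 * B := by ring
      have h8 : 0 ≤ (‖(p : EuclideanSpace ℝ (Fin 3)) - q‖⁻¹) ^ 8 := by positivity
      calc 38 * (‖(p : EuclideanSpace ℝ (Fin 3)) - q‖⁻¹) ^ 8 * ‖v p - v q‖ * B
          ≤ 38 * (‖(p : EuclideanSpace ℝ (Fin 3)) - q‖⁻¹) ^ 8 * (2 * B) * B := by gcongr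
        _ = 38 * (2 * B) * B * (dist (q : EuclideanSpace ℝ (Fin 3)) p)⁻¹ ^ 8 := by
            rw [dist_comm, dist_eq_norm]; ring

end

/-! ## The identity -/

section Identity

variable {t : Fin 2 → EuclideanSpace ℝ (Fin 3)} {A : EuclideanSpace ℝ (Fin 3) →L[ℝ] EuclideanSpace ℝ (Fin 3)}

/-- Pointwise pair splitting of the quadratic form: `F(p,q) = G(p,q) + G(q,p)`. [folklore] -/
theorem hessTerm_eq_pair_add (v : (EuclideanSpace ℝ (Fin 3)) → (EuclideanSpace ℝ (Fin 3))) (p q : Sites₀ t A) :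
    (if (p : (EuclideanSpace ℝ (Fin 3))) ≠ q then Hess₀ ((p : (EuclideanSpace ℝ (Fin 3))) - q) (v p - v q) else 0) =
      (if (p : (EuclideanSpace ℝ (Fin 3))) ≠ q then ⟪((-((‖(p : (EuclideanSpace ℝ (Fin 3))) - q‖ ^ 2)⁻¹) ^ 7 + ((‖(p : (EuclideanSpace ℝ (Fin 3))) - q‖ ^ 2)⁻¹) ^ 4) • (v p - v q) + (2 * ⟪(p : (EuclideanSpace ℝ (Fin 3))) - q, v p - v q⟫ * (7 * ((‖(p : (EuclideanSpace ℝ (Fin 3))) - q‖ ^ 2)⁻¹) ^ 8 - 4 * ((‖(p : (EuclideanSpace ℝ (Fin 3))) - q‖ ^ 2)⁻¹) ^ 5)) • ((p : (EuclideanSpace ℝ (Fin 3))) - q)), v p⟫ else 0) +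
      (if (q : (EuclideanSpace ℝ (Fin 3))) ≠ p then ⟪((-((‖(q : (EuclideanSpace ℝ (Fin 3))) - p‖ ^ 2)⁻¹) ^ 7 + ((‖(q : (EuclideanSpace ℝ (Fin 3))) - p‖ ^ 2)⁻¹) ^ 4) • (v q - v p) + (2 * ⟪(q : (EuclideanSpace ℝ (Fin 3))) - p, v q - v p⟫ * (7 * ((‖(q : (EuclideanSpace ℝ (Fin 3))) - p‖ ^ 2)⁻¹) ^ 8 - 4 * ((‖(q : (EuclideanSpace ℝ (Fin 3))) - p‖ ^ 2)⁻¹) ^ 5)) • ((q : (EuclideanSpace ℝ (Fin 3))) - p)), v q⟫ else 0) := by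
  by_cases hpq : (p : (EuclideanSpace ℝ (Fin 3))) = q
  · simp [hpq]
  · have hqp : (q : (EuclideanSpace ℝ (Fin 3))) ≠ p := fun h => hpq h.symm
    rw [if_pos hpq, if_pos hpq, if_pos hqp]
    have hne : (p : (EuclideanSpace ℝ (Fin 3))) - q ≠ 0 := sub_ne_zero.2 hpq
    rw [← inner_forceConst_eq_Hess₀ hne (v p - v q), inner_forceConst_pair ((p : (EuclideanSpace ℝ (Fin 3))) - q) (v p) (v q)]
    rw [neg_sub]

/-- The row family `q ↦ G(p,q)` is summable. [folklore] -/
theorem summable_pairRow (hA : Adm₀ A) (hI : Inner₀ t A) {v : (EuclideanSpace ℝ (Fin 3)) → (EuclideanSpace ℝ (Fin 3))}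
    (hv : (Function.support v).Finite) (p : Sites₀ t A) :
    Summable (fun q : Sites₀ t A => (if (p : (EuclideanSpace ℝ (Fin 3))) ≠ q then ⟪((-((‖(p : (EuclideanSpace ℝ (Fin 3))) - q‖ ^ 2)⁻¹) ^ 7 + ((‖(p : (EuclideanSpace ℝ (Fin 3))) - q‖ ^ 2)⁻¹) ^ 4) • (v p - v q) + (2 * ⟪(p : (EuclideanSpace ℝ (Fin 3))) - q, v p - v q⟫ * (7 * ((‖(p : (EuclideanSpace ℝ (Fin 3))) - q‖ ^ 2)⁻¹) ^ 8 - 4 * ((‖(p : (EuclideanSpace ℝ (Fin 3))) - q‖ ^ 2)⁻¹) ^ 5)) • ((p : (EuclideanSpace ℝ (Fin 3))) - q)), v p⟫ else 0)) := by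
  have h := (summable_opRow hA hI hv p).mapL (innerSL ℝ (v p))
  refine h.congr fun q => ?_
  by_cases hpq : (p : (EuclideanSpace ℝ (Fin 3))) = q
  · simp [hpq]
  · rw [if_pos hpq, if_pos hpq, innerSL_apply_apply, real_inner_comm]

/-- The column family `q ↦ G(q,p)` is finitely supported, hence summable. [folklore] -/
theorem summable_pairCol {v : (EuclideanSpace ℝ (Fin 3)) → (EuclideanSpace ℝ (Fin 3))}
    (hv : (Function.support v).Finite) (p : Sites₀ t A) :
    Summable (fun q : Sites₀ t A => (if (q : (EuclideanSpace ℝ (Fin 3))) ≠ p then ⟪((-((‖(q : (EuclideanSpace ℝ (Fin 3))) - p‖ ^ 2)⁻¹) ^ 7 + ((‖(q : (EuclideanSpace ℝ (Fin 3))) - p‖ ^ 2)⁻¹) ^ 4) • (v q - v p) + (2 * ⟪(q : (EuclideanSpace ℝ (Fin 3))) - p, v q - v p⟫ * (7 * ((‖(q : (EuclideanSpace ℝ (Fin 3))) - p‖ ^ 2)⁻¹) ^ 8 - 4 * ((‖(q : (EuclideanSpace ℝ (Fin 3))) - p‖ ^ 2)⁻¹) ^ 5)) • ((q : (EuclideanSpace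 ℝ (Fin 3))) - p)), v q⟫ else 0)) := by
  classical
  refine summable_of_ne_finset_zero (s := (finite_support_sites (t := t) (A := A) hv).toFinset) ?_
  intro q hq
  have hvq : v q = 0 := by
    by_contra h
    exact hq ((Set.Finite.mem_toFinset _).2 h)
  simp [hvq]

/-- Row sums of the quadratic form split: `Σ'_q F(p,q) = Σ'_q G(p,q) + Σ'_q G(q,p)`. [folklore] -/
theorem tsum_hessRow_eq (hA : Adm₀ A) (hI : Inner₀ t A) {v : (EuclideanSpace ℝ (Fin 3)) → (EuclideanSpace ℝ (Fin 3))}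
    (hv : (Function.support v).Finite) (p : Sites₀ t A) :
    (∑' q : Sites₀ t A, (if (p : (EuclideanSpace ℝ (Fin 3))) ≠ q then Hess₀ ((p : (EuclideanSpace ℝ (Fin 3))) - q) (v p - v q) else 0)) =
      (∑' q : Sites₀ t A, (if (p : (EuclideanSpace ℝ (Fin 3))) ≠ q then ⟪((-((‖(p : (EuclideanSpace ℝ (Fin 3))) - q‖ ^ 2)⁻¹) ^ 7 + ((‖(p : (EuclideanSpace ℝ (Fin 3))) - q‖ ^ 2)⁻¹) ^ 4) • (v p - v q) + (2 * ⟪(p : (EuclideanSpace ℝ (Fin 3))) - q, v p - v q⟫ * (7 * ((‖(p : (EuclideanSpace ℝ (Fin 3))) - q‖ ^ 2)⁻¹) ^ 8 - 4 * ((‖(p : (EuclideanSpace ℝ (Fin 3))) - q‖ ^ 2)⁻¹) ^ 5)) • ((p : (EuclideanSpace ℝ (Fin 3))) - q)), v p⟫ else 0)) +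
      ∑' q : Sites₀ t A, (if (q : (EuclideanSpace ℝ (Fin 3))) ≠ p then ⟪((-((‖(q : (EuclideanSpace ℝ (Fin 3))) - p‖ ^ 2)⁻¹) ^ 7 + ((‖(q : (EuclideanSpace ℝ (Fin 3))) - p‖ ^ 2)⁻¹) ^ 4) • (v q - v p) + (2 * ⟪(q : (EuclideanSpace ℝ (Fin 3))) - p, v q - v p⟫ * (7 * ((‖(q : (EuclideanSpace ℝ (Fin 3))) - p‖ ^ 2)⁻¹) ^ 8 - 4 * ((‖(q : (EuclideanSpace ℝ (Fin 3))) - p‖ ^ 2)⁻¹) ^ 5)) • ((q : (EuclideanSpace ℝ (Fin 3))) - p)), v q⟫ else 0) := by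
  rw [← (summable_pairRow hA hI hv p).tsum_add (summable_pairCol hv p)]
  exact tsum_congr fun q => hessTerm_eq_pair_add v p q

/-- The operator row paired with `v p`: `Σ'_q G(p,q) = ⟪(L v)(p), v p⟫`. [folklore] -/
theorem tsum_pairRow_eq_inner (hA : Adm₀ A) (hI : Inner₀ t A) {v : (EuclideanSpace ℝ (Fin 3)) → (EuclideanSpace ℝ (Fin 3))}
    (hv : (Function.support v).Finite) (p : Sites₀ t A) :
    (∑' q : Sites₀ t A, (if (p : (EuclideanSpace ℝ (Fin 3))) ≠ q then ⟪((-((‖(p : (EuclideanSpace ℝ (Fin 3))) - q‖ ^ 2)⁻¹) ^ 7 + ((‖(p : (EuclideanSpace ℝ (Fin 3))) - q‖ ^ 2)⁻¹) ^ 4) • (v p - v q) + (2 * ⟪(p : (EuclideanSpace ℝ (Fin 3))) - q, v p - v q⟫ * (7 * ((‖(p : (EuclideanSpace ℝ (Fin 3))) - q‖ ^ 2)⁻¹) ^ 8 - 4 * ((‖(p : (EuclideanSpace ℝ (Fin 3))) - q‖ ^ 2)⁻¹) ^ 5)) • ((p : (EuclideanSpace ℝ (Fin 3))) - q)), v p⟫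 else 0)) =
      ⟪∑' q : Sites₀ t A, (if (p : (EuclideanSpace ℝ (Fin 3))) ≠ q then ((-((‖(p : (EuclideanSpace ℝ (Fin 3))) - q‖ ^ 2)⁻¹) ^ 7 + ((‖(p : (EuclideanSpace ℝ (Fin 3))) - q‖ ^ 2)⁻¹) ^ 4) • (v p - v q) + (2 * ⟪(p : (EuclideanSpace ℝ (Fin 3))) - q, v p - v q⟫ * (7 * ((‖(p : (EuclideanSpace ℝ (Fin 3))) - q‖ ^ 2)⁻¹) ^ 8 - 4 * ((‖(p : (EuclideanSpace ℝ (Fin 3))) - q‖ ^ 2)⁻¹) ^ 5)) • ((p : (EuclideanSpace ℝ (Fin 3))) - q)) else 0), v p⟫ := by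
  have hs := summable_opRow hA hI hv p
  rw [real_inner_comm, ← innerSL_apply_apply (𝕜 := ℝ), ContinuousLinearMap.map_tsum (innerSL ℝ (v p)) hs]
  refine tsum_congr fun q => ?_
  by_cases hpq : (p : (EuclideanSpace ℝ (Fin 3))) = q
  · simp [hpq]
  · rw [if_pos hpq, if_pos hpq, innerSL_apply_apply, real_inner_comm]

/-- **The energy identity**: for an admissible datum and a finitely supported displacement `v`,
`Σ'_p ⟪(L v)(p), v p⟫ = ½ Σ'_p Σ'_q [p≠q] Hess₀ (p−q) (v p − v q)` — the route's stability form IS the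
quadratic form of the force-constant operator of the linearised equation. [folklore] -/
theorem energy_identity (hA : Adm₀ A) (hI : Inner₀ t A) {v : (EuclideanSpace ℝ (Fin 3)) → (EuclideanSpace ℝ (Fin 3))}
    (hv : (Function.support v).Finite) :
    (∑' p : Sites₀ t A, ⟪∑' q : Sites₀ t A, (if (p : (EuclideanSpace ℝ (Fin 3))) ≠ q then ((-((‖(p : (EuclideanSpace ℝ (Fin 3))) - q‖ ^ 2)⁻¹) ^ 7 + ((‖(p : (EuclideanSpace ℝ (Fin 3))) - q‖ ^ 2)⁻¹) ^ 4) • (v p - v q) + (2 * ⟪(p : (EuclideanSpace ℝ (Fin 3))) - q, v p - v q⟫ * (7 * ((‖(p : (EuclideanSpace ℝ (Fin 3))) - q‖ ^ 2)⁻¹) ^ 8 - 4 * ((‖(p : (EuclideanSpace ℝ (Fin 3))) - q‖ ^ 2)⁻¹) ^ 5)) • ((p : (EuclideanSpace ℝ (Fin 3))) - q)) else 0), v p⟫) =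
      (1 / 2 : ℝ) * ∑' p : Sites₀ t A, ∑' q : Sites₀ t A, (if (p : (EuclideanSpace ℝ (Fin 3))) ≠ q then Hess₀ ((p : (EuclideanSpace ℝ (Fin 3))) - q) (v p - v q) else 0) := by
  -- uncurried summability of G and the two iterated sums
  have hG : Summable (Function.uncurry fun (p q : Sites₀ t A) => (if (p : (EuclideanSpace ℝ (Fin 3))) ≠ q then ⟪((-((‖(p : (EuclideanSpace ℝ (Fin 3))) - q‖ ^ 2)⁻¹) ^ 7 + ((‖(p : (EuclideanSpace ℝ (Fin 3))) - q‖ ^ 2)⁻¹) ^ 4) • (v p - v q) + (2 * ⟪(p : (EuclideanSpace ℝ (Fin 3))) - q, v p - v q⟫ * (7 * ((‖(p : (EuclideanSpace ℝ (Fin 3))) - q‖ ^ 2)⁻¹) ^ 8 - 4 * ((‖(p : (EuclideanSpace ℝ (Fin 3))) - q‖ ^ 2)⁻¹) ^ 5)) • ((p : (EuclideanSpace ℝ (Fin 3))) - q)), v p⟫ else 0)) :=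
    summable_pairFamily hA hI hv
  have hA' : Summable (fun p : Sites₀ t A => ∑' q : Sites₀ t A, (if (p : (EuclideanSpace ℝ (Fin 3))) ≠ q then ⟪((-((‖(p : (EuclideanSpace ℝ (Fin 3))) - q‖ ^ 2)⁻¹) ^ 7 + ((‖(p : (EuclideanSpace ℝ (Fin 3))) - q‖ ^ 2)⁻¹) ^ 4) • (v p - v q) + (2 * ⟪(p : (EuclideanSpace ℝ (Fin 3))) - q, v p - v q⟫ * (7 * ((‖(p : (EuclideanSpace ℝ (Fin 3))) - q‖ ^ 2)⁻¹) ^ 8 - 4 * ((‖(p : (EuclideanSpace ℝ (Fin 3))) - q‖ ^ 2)⁻¹) ^ 5)) • ((p : (EuclideanSpace ℝ (Fin 3))) - q)), v p⟫ else 0)) := hG.prod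
  have hB' : Summable (fun p : Sites₀ t A => ∑' q : Sites₀ t A, (if (q : (EuclideanSpace ℝ (Fin 3))) ≠ p then ⟪((-((‖(q : (EuclideanSpace ℝ (Fin 3))) - p‖ ^ 2)⁻¹) ^ 7 + ((‖(q : (EuclideanSpace ℝ (Fin 3))) - p‖ ^ 2)⁻¹) ^ 4) • (v q - v p) + (2 * ⟪(q : (EuclideanSpace ℝ (Fin 3))) - p, v q - v p⟫ * (7 * ((‖(q : (EuclideanSpace ℝ (Fin 3))) - p‖ ^ 2)⁻¹) ^ 8 - 4 * ((‖(q : (EuclideanSpace ℝ (Fin 3))) - p‖ ^ 2)⁻¹) ^ 5)) • ((q : (EuclideanSpace ℝ (Fin 3))) - p)), v q⟫ else 0)) := hG.prod_symm.prod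
  have hcomm : (∑' p : Sites₀ t A, ∑' q : Sites₀ t A, (if (q : (EuclideanSpace ℝ (Fin 3))) ≠ p then ⟪((-((‖(q : (EuclideanSpace ℝ (Fin 3))) - p‖ ^ 2)⁻¹) ^ 7 + ((‖(q : (EuclideanSpace ℝ (Fin 3))) - p‖ ^ 2)⁻¹) ^ 4) • (v q - v p) + (2 * ⟪(q : (EuclideanSpace ℝ (Fin 3))) - p, v q - v p⟫ * (7 * ((‖(q : (EuclideanSpace ℝ (Fin 3))) - p‖ ^ 2)⁻¹) ^ 8 - 4 * ((‖(q : (EuclideanSpace ℝ (Fin 3))) - p‖ ^ 2)⁻¹) ^ 5)) • ((q : (EuclideanSpace ℝ (Fin 3))) - p)), v q⟫ else 0)) =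
      ∑' p : Sites₀ t A, ∑' q : Sites₀ t A, (if (p : (EuclideanSpace ℝ (Fin 3))) ≠ q then ⟪((-((‖(p : (EuclideanSpace ℝ (Fin 3))) - q‖ ^ 2)⁻¹) ^ 7 + ((‖(p : (EuclideanSpace ℝ (Fin 3))) - q‖ ^ 2)⁻¹) ^ 4) • (v p - v q) + (2 * ⟪(p : (EuclideanSpace ℝ (Fin 3))) - q, v p - v q⟫ * (7 * ((‖(p : (EuclideanSpace ℝ (Fin 3))) - q‖ ^ 2)⁻¹) ^ 8 - 4 * ((‖(p : (EuclideanSpace ℝ (Fin 3))) - q‖ ^ 2)⁻¹) ^ 5)) • ((p : (EuclideanSpace ℝ (Fin 3))) - q)), v p⟫ else 0) := hG.tsum_comm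
  have hsplit : (∑' p : Sites₀ t A, ∑' q : Sites₀ t A, (if (p : (EuclideanSpace ℝ (Fin 3))) ≠ q then Hess₀ ((p : (EuclideanSpace ℝ (Fin 3))) - q) (v p - v q) else 0)) =
      (∑' p : Sites₀ t A, ∑' q : Sites₀ t A, (if (p : (EuclideanSpace ℝ (Fin 3))) ≠ q then ⟪((-((‖(p : (EuclideanSpace ℝ (Fin 3))) - q‖ ^ 2)⁻¹) ^ 7 + ((‖(p : (EuclideanSpace ℝ (Fin 3))) - q‖ ^ 2)⁻¹) ^ 4) • (v p - v q) + (2 * ⟪(p : (EuclideanSpace ℝ (Fin 3))) - q, v p - v q⟫ * (7 * ((‖(p : (EuclideanSpace ℝ (Fin 3))) - q‖ ^ 2)⁻¹) ^ 8 - 4 * ((‖(p : (EuclideanSpace ℝ (Fin 3))) - q‖ ^ 2)⁻¹) ^ 5)) • ((p : (EuclideanSpace ℝ (Fin 3))) - q)), v p⟫ else 0)) +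
      ∑' p : Sites₀ t A, ∑' q : Sites₀ t A, (if (q : (EuclideanSpace ℝ (Fin 3))) ≠ p then ⟪((-((‖(q : (EuclideanSpace ℝ (Fin 3))) - p‖ ^ 2)⁻¹) ^ 7 + ((‖(q : (EuclideanSpace ℝ (Fin 3))) - p‖ ^ 2)⁻¹) ^ 4) • (v q - v p) + (2 * ⟪(q : (EuclideanSpace ℝ (Fin 3))) - p, v q - v p⟫ * (7 * ((‖(q : (EuclideanSpace ℝ (Fin 3))) - p‖ ^ 2)⁻¹) ^ 8 - 4 * ((‖(q : (EuclideanSpace ℝ (Fin 3))) - p‖ ^ 2)⁻¹) ^ 5)) • ((q : (EuclideanSpace ℝ (Fin 3))) - p)), v q⟫ else 0) := by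
    rw [← hA'.tsum_add hB']
    exact tsum_congr fun p => tsum_hessRow_eq hA hI hv p
  rw [hsplit, hcomm, tsum_congr fun p => (tsum_pairRow_eq_inner hA hI hv p).symm]
  ring

/-- **Harmonic stability is coercivity of the force-constant operator.**  Under the route's
`PhononStability` there is `κ > 0` such that for every admissible datum and every finitely supported
displacement `v` on its sites, `κ · nnForm t A v ≤ Σ'_p ⟪(L v)(p), v p⟫` (the nearest-neighbour strain
energy is controlled by the work of the linearised forces).  From `phononStability_iff` and
`energy_identity`. [folklore] -/
theorem coercive_of_phononStability
    (hPS : Summit.AtomisticToContinuum.Crystallization.Theses.ExcessDecayLiouville.PhononStability) :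
    ∃ κ : ℝ, 0 < κ ∧ ∀ (t : Fin 2 → (EuclideanSpace ℝ (Fin 3))) (A : (EuclideanSpace ℝ (Fin 3)) →L[ℝ] (EuclideanSpace ℝ (Fin 3))), Adm₀ A → Inner₀ t A →
      ∀ v : (EuclideanSpace ℝ (Fin 3)) → (EuclideanSpace ℝ (Fin 3)), (Function.support v).Finite → Function.support v ⊆ Sites₀ t A →
        κ * nnForm t A v ≤ ∑' p : Sites₀ t A, ⟪∑' q : Sites₀ t A, (if (p : (EuclideanSpace ℝ (Fin 3))) ≠ q then ((-((‖(p : (EuclideanSpace ℝ (Fin 3))) - q‖ ^ 2)⁻¹) ^ 7 + ((‖(p : (EuclideanSpace ℝ (Fin 3))) - q‖ ^ 2)⁻¹) ^ 4) • (v p - v q) + (2 * ⟪(p : (EuclideanSpace ℝ (Fin 3))) - q, v p - v q⟫ * (7 * ((‖(p : (EuclideanSpace ℝ (Fin 3))) - q‖ ^ 2)⁻¹) ^ 8 - 4 * ((‖(p : (EuclideanSpace ℝ (Fin 3))) - q‖ ^ 2)⁻¹) ^ 5)) • ((p : (EuclideanSpace ℝ (Fin 3))) - q)) else 0), v p⟫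 := by
  obtain ⟨κ, hκ, h⟩ := phononStability_iff.1 hPS
  refine ⟨κ, hκ, fun t A hA hI v hv hvS => ?_⟩
  have h1 := h t A hA hI v hv hvS
  rw [energy_identity hA hI hv]
  unfold hessForm at h1
  linarith

end Identity

end Summit.AtomisticToContinuum.Crystallization.Theorems.ExcessDecayLiouville

end
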